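import Summits.HodgeConjecture.HodgeConjecture.Theses.NikulinTwinTransport

/-!
# Route NikulinTwinTransport — `SectorComplement`: exact logical status of the declared frame

Item stmt-HodgeConjecture-13684 (`SectorComplement := SquareHodgeOfSqrtTwo → HodgeConjecture`, support,
"bookkeeping, NOT claimed"): the complement of the route's sector. The sector `SquareHodgeOfSqrtTwo`
(stmt-HodgeConjecture-13680) concludes `HodgeConjectureFor 4 (S ⊗ S)` for projective K3-type surfaces
`S` (smooth projective of dimension `2`, `H¹(𝒪) = 0`, a nowhere-vanishing holomorphic `2`-form on a
Hodge model) carrying real multiplication by `√2` on `NS(S)^⊥`.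

This file records, kernel-checked and with no hypotheses beyond the route's own declarations, why the
item can be settled in neither direction short of deciding the Clay problem itself:

* `nikulinTwinTransport_sectorComplement_of_hodgeConjecture` : `HC → SectorComplement` (trivial);
* `nikulinTwinTransport_squareHodgeOfSqrtTwo_of_hodgeConjecture` : `HC → SquareHodgeOfSqrtTwo` — the
  sector is a special case of the summit, because `S ⊗ S` is smooth projective of dimension `2 + 2`
  (`Literature.AlgebraicGeometry.Motives.IsSmoothProjective.tensor_holds`, Hartshorne III 10.1 (d) +
  Segre); hence the only way to PROVE the frame without proving `HC` — refuting its antecedent —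
  refutes `HC` (`nikulinTwinTransport_not_hodgeConjecture_of_not_squareHodgeOfSqrtTwo`);
* `nikulinTwinTransport_not_sectorComplement_iff` : `¬ SectorComplement ↔ SquareHodgeOfSqrtTwo ∧ ¬ HC`
  — a refutation must prove the whole sector AND disprove `HC`;
* `nikulinTwinTransport_sectorComplement_iff` : `SectorComplement ↔ ¬ SquareHodgeOfSqrtTwo ∨ HC`;
* `nikulinTwinTransport_hodgeConjecture_iff_sector_and_complement` :
  `HC ↔ SquareHodgeOfSqrtTwo ∧ SectorComplement` — the frame is exactly "HC minus the sector"
  (D-0027 §2.1), and `nikulinTwinTransport_sectorComplement_iff_hodgeConjecture` : once the route has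
  delivered its sector, the frame IS the summit.

Nothing here asserts a Theses decl; every statement is an implication from `HodgeConjecture`, a
negation, or an equivalence. Prover seat prover-pitem-stmt-HodgeConjecture-13684-0, 2026-08-16.
-/

namespace Summit.HodgeConjecture.HodgeConjecture.Theorems

open Summit.HodgeConjecture.HodgeConjecture.Theses.NikulinTwinTransport
open Literature.AlgebraicGeometry.Motives

/-- `HC → SectorComplement`: the frame is a weakening of the summit. [folklore] -/
theorem nikulinTwinTransport_sectorComplement_of_hodgeConjecture :
    _root_.HodgeConjecture → SectorComplement :=
  fun hHC _ ↦ hHC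

/-- **The sector is a special case of the summit**: `HC → SquareHodgeOfSqrtTwo`, since for a smooth
projective surface `S` the square `S ⊗ S` is smooth projective of dimension `2 + 2 = 4`
(`IsSmoothProjective.tensor_holds`: Hartshorne III Prop. 10.1 (d), Stacks 038F, Segre embedding), so
`HodgeConjecture` applies to it verbatim; none of the real-multiplication hypotheses is used. [folklore] -/
theorem nikulinTwinTransport_squareHodgeOfSqrtTwo_of_hodgeConjecture :
    _root_.HodgeConjecture → SquareHodgeOfSqrtTwo := by
  intro hHC S hS _ _ _ _ _ _ _
  exact hHC (IsSmoothProjective.tensor_holds hS.1 hS.1)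

/-- Refuting the sector refutes the Hodge conjecture (contrapositive of
`nikulinTwinTransport_squareHodgeOfSqrtTwo_of_hodgeConjecture`): the only way to prove the frame
`SectorComplement` other than proving `HC` is a disproof of `HC`. [folklore] -/
theorem nikulinTwinTransport_not_hodgeConjecture_of_not_squareHodgeOfSqrtTwo
    (h : ¬ SquareHodgeOfSqrtTwo) : ¬ _root_.HodgeConjecture :=
  fun hHC ↦ h (nikulinTwinTransport_squareHodgeOfSqrtTwo_of_hodgeConjecture hHC)

/-- The exact content of a refutation of the frame:
`¬ SectorComplement ↔ SquareHodgeOfSqrtTwo ∧ ¬ HC` (classical `¬ (P → Q) ↔ P ∧ ¬ Q`); in particular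
(`.1 h |>.2`) any refutation of the frame is a disproof of the Hodge conjecture. [folklore] -/
theorem nikulinTwinTransport_not_sectorComplement_iff :
    ¬ SectorComplement ↔ SquareHodgeOfSqrtTwo ∧ ¬ _root_.HodgeConjecture :=
  Classical.not_imp

/-- Truth table of the frame: `SectorComplement ↔ ¬ SquareHodgeOfSqrtTwo ∨ HC` — provable only by
proving `HC` or by refuting the sector (which refutes `HC`), refutable only in the world "`HC` fails
but holds on every square of a K3 surface with real multiplication by `√2`". [folklore] -/
theorem nikulinTwinTransport_sectorComplement_iff :
    SectorComplement ↔ ¬ SquareHodgeOfSqrtTwo ∨ _root_.HodgeConjecture := by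
  constructor
  · intro h
    by_cases hS : SquareHodgeOfSqrtTwo
    · exact Or.inr (h hS)
    · exact Or.inl hS
  · rintro (hS | hHC) hS'
    · exact absurd hS' hS
    · exact hHC

/-- Bookkeeping identity of the D-0027 §2.1 frame: `HC ↔ SquareHodgeOfSqrtTwo ∧ SectorComplement` —
the declared, not-claimed item is exactly "the Hodge conjecture minus the route's sector". [folklore] -/
theorem nikulinTwinTransport_hodgeConjecture_iff_sector_and_complement :
    _root_.HodgeConjecture ↔ SquareHodgeOfSqrtTwo ∧ SectorComplement :=
  ⟨fun hHC ↦ ⟨nikulinTwinTransport_squareHodgeOfSqrtTwo_of_hodgeConjecture hHC, fun _ ↦ hHC⟩,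
    fun h ↦ h.2 h.1⟩

/-- Once the route has delivered its sector, the frame IS the summit:
`SquareHodgeOfSqrtTwo → (SectorComplement ↔ HC)`. [folklore] -/
theorem nikulinTwinTransport_sectorComplement_iff_hodgeConjecture (hS : SquareHodgeOfSqrtTwo) :
    SectorComplement ↔ _root_.HodgeConjecture :=
  ⟨fun h ↦ h hS, fun hHC _ ↦ hHC⟩

end Summit.HodgeConjecture.HodgeConjecture.Theorems
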